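import Summits.CriticalPhenomena.PercolationContinuityZ3.Theorems.PercNearOneGluingNoHeavyLowerTailStarSetClassForestComonotone
import Summits.CriticalPhenomena.PercolationContinuityZ3.Theorems.PercNearOneGluingNoHeavyLowerTailStarSetStateExpansion
import Summits.CriticalPhenomena.PercolationContinuityZ3.Theorems.PercNearOneGluingNoHeavyLowerTailStarSetLevelTwo
import HarnessLib

/-!
# `NoHeavyLowerTail` (stmt-CriticalPhenomena-4575) — OES at level `j ≤ 2` for two-port pendant stars whose CLASS graph is a forest

Support file (prover `prim-gen-swap` gen 8; `--supports stmt-CriticalPhenomena-4575`).  No definitions, no named facts, no sorries.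

**Theorem (`StarSet.setCS_twoPortStarClassForest_levelTwo`).**  As `StarSet.setCS_twoPortStarForest_levelTwo` (…StarSetForestLevelTwo), but
PARALLEL stars (several stars on the same port pair) are allowed: the stars `i : Fin m` are grouped into classes `cls i : Fin M` with class
ports `P, P' : Fin M → Fin n` (`p i = P (cls i)`, `p' i = P' (cls i)`), and the leaf-peeling hypothesis `K < I → P' K ∉ {P I, P' I}` is imposed
on the CLASSES only (seat memo CYCLES-CERT.md §1; every port multigraph without cycles of length `≥ 3` admits such a presentation).  Conclusion:
`CS_w(S, c)` for `S = {s i}`, `c ∈ A` off the ports dominating them, every `|A|`, every `m`.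
Proof: state expansion (`StarSet.setCSdiff_state_expansion`) + extreme regrouping (`StarSet.extreme_regroup`) + glued words
(`StarSet.gluedWord_nonneg`, no port-graph hypothesis) + the comonotone word via the class-forest certificate
(`StarSet.comonotone_word_nonneg_classForest`).
-/

noncomputable section

namespace Summit.CriticalPhenomena.PercolationContinuityZ3.Theorems

open MeasureTheory Set Literature.Probability.LatticeModels Literature.Probability.Percolation
open scoped Classical BigOperators

variable {n m M : ℕ}

namespace StarSet

/-- **The comonotone word is nonnegative for class forests** (cell port sets `Y(σ) = P_σ`; restatement of
`StarSet.comonotone_word_nonneg_classForest` for any description of the port sets by membership). [folklore] -/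
theorem comonotoneWord_nonneg_classForest (w : Sym2 (Fin n) → unitInterval) (A : Finset (Fin n)) (s p p' : Fin m → Fin n)
    (cls : Fin m → Fin M) (P P' : Fin M → Fin n) (hP : ∀ i, p i = P (cls i)) (hP' : ∀ i, p' i = P' (cls i))
    (c : Fin n) (j : ℕ) (hj : j ≤ 2) (hs : Function.Injective s) (hsA : ∀ i, s i ∉ A)
    (hPA : ∀ I, P I ∈ A) (hP'A : ∀ I, P' I ∈ A) (hPP' : ∀ I, P I ≠ P' I)
    (hforest : ∀ K I, K < I → P' K ≠ P I ∧ P' K ≠ P' I) (hcA : c ∈ A)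
    (hcP : ∀ I, c ≠ P I ∧ c ≠ P' I) (hwjunk : ∀ i u, u ≠ s i → u ≠ p i → u ≠ p' i → w s(s i, u) = 0)
    (hdom : ∀ I, (prodBernoulli w).real {ω : BondConfig (Fin n) | (A.filter fun z => ω ∈ openConn (P I) z).card ≤ j} ≤
      (prodBernoulli w).real {ω : BondConfig (Fin n) | (A.filter fun z => ω ∈ openConn c z).card ≤ j})
    (Y : Finset (Fin m) → Finset (Fin n)) (hY : ∀ σ, Y σ = σ.image p ∪ σ.image p') :
    0 ≤ ∑ σ ∈ (Finset.univ : Finset (Fin m)).powerset,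
      ((∏ i ∈ σ, ((w s(s i, p i) : ℝ) * w s(s i, p' i))) *
          ∏ i ∈ Finset.univ \ σ, (1 - (w s(s i, p i) : ℝ) * w s(s i, p' i))) *
        ((prodBernoulli w).real {ω : BondConfig (Fin n) |
            (∀ u ∈ Y σ, ¬ (openGraph (ω ∩ {e | ∀ v ∈ Finset.univ.image s, v ∉ e})).Reachable c u) ∧
            (A.filter fun z => (openGraph (ω ∩ {e | ∀ v ∈ Finset.univ.image s, v ∉ e})).Reachable c z).card ≤ j} -
          (prodBernoulli w).real {ω : BondConfig (Fin n) |
            (∀ u ∈ Y σ, ¬ (openGraph (ω ∩ {e | ∀ v ∈ Finset.univ.image s, v ∉ e})).Reachable c u) ∧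
            1 ≤ (A.filter fun z => ∃ u ∈ Y σ, (openGraph (ω ∩ {e | ∀ v ∈ Finset.univ.image s, v ∉ e})).Reachable u z).card ∧
            (A.filter fun z => ∃ u ∈ Y σ,
              (openGraph (ω ∩ {e | ∀ v ∈ Finset.univ.image s, v ∉ e})).Reachable u z).card ≤ j}) := by
  have h := comonotone_word_nonneg_classForest w A s p p' cls P P' hP hP' c j hj hs hsA hPA hP'A hPP' hforest hcA hcP hwjunk hdom
  refine le_trans h (le_of_eq (Finset.sum_congr rfl fun σ _ => ?_))
  rw [hY σ]

/-- **OES at level `j ≤ 2` for two-port pendant stars whose CLASS graph is a forest (parallel stars allowed, any number of stars).**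
Stars `s i ∉ A` (pairwise distinct) grouped into classes `cls i` with class ports `P (cls i) = p i ≠ p' i = P' (cls i)` in `A`, the classes
indexed in a leaf-peeling order (`K < I → P' K ∉ {P I, P' I}`); `c ∈ A` off the ports, dominating every class port.  Then
`μ(c ↮ S, 1 ≤ |π(S)| ≤ j) ≤ μ(c ↮ S, |π(c)| ≤ j)` for `S = {s i : i < m}`.
[cite: VandenbergHaggstromKahn2005, Thm. 1.5 (p. 7) — the only non-elementary input, via `observerSet_le_of_lonelier`] -/
theorem setCS_twoPortStarClassForest_levelTwo (w : Sym2 (Fin n) → unitInterval) (A : Finset (Fin n)) (s p p' : Fin m → Fin n)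
    (cls : Fin m → Fin M) (P P' : Fin M → Fin n) (hP : ∀ i, p i = P (cls i)) (hP' : ∀ i, p' i = P' (cls i))
    (c : Fin n) (j : ℕ) (hj : j ≤ 2) (hs : Function.Injective s) (hsA : ∀ i, s i ∉ A)
    (hPA : ∀ I, P I ∈ A) (hP'A : ∀ I, P' I ∈ A) (hPP' : ∀ I, P I ≠ P' I)
    (hforest : ∀ K I, K < I → P' K ≠ P I ∧ P' K ≠ P' I)
    (hcA : c ∈ A) (hcP : ∀ I, c ≠ P I ∧ c ≠ P' I)
    (hobs : ∀ i u, u ≠ s i → u ≠ p i → u ≠ p' i → w s(s i, u) = 0)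
    (hdom : ∀ I,
      (prodBernoulli w).real {ω : BondConfig (Fin n) | (A.filter fun z => ω ∈ openConn (P I) z).card ≤ j} ≤
          (prodBernoulli w).real {ω : BondConfig (Fin n) | (A.filter fun z => ω ∈ openConn c z).card ≤ j} ∧
        (prodBernoulli w).real {ω : BondConfig (Fin n) | (A.filter fun z => ω ∈ openConn (P' I) z).card ≤ j} ≤
          (prodBernoulli w).real {ω : BondConfig (Fin n) | (A.filter fun z => ω ∈ openConn c z).card ≤ j}) :
    (prodBernoulli w).real {ω : BondConfig (Fin n) | (∀ x ∈ Finset.univ.image s, ω ∉ openConn c x) ∧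
        1 ≤ (A.filter fun z => ∃ x ∈ Finset.univ.image s, ω ∈ openConn x z).card ∧
        (A.filter fun z => ∃ x ∈ Finset.univ.image s, ω ∈ openConn x z).card ≤ j} ≤
      (prodBernoulli w).real {ω : BondConfig (Fin n) | (∀ x ∈ Finset.univ.image s, ω ∉ openConn c x) ∧
        (A.filter fun z => ω ∈ openConn c z).card ≤ j} := by
  -- star-level facts
  have hpA : ∀ i, p i ∈ A := fun i => (hP i) ▸ hPA (cls i)
  have hp'A : ∀ i, p' i ∈ A := fun i => (hP' i) ▸ hP'A (cls i)
  have hpp' : ∀ i, p i ≠ p' i := fun i => by rw [hP i, hP' i]; exact hPP' (cls i)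
  have hcp : ∀ i, c ≠ p i ∧ c ≠ p' i := fun i => by rw [hP i, hP' i]; exact hcP (cls i)
  have hdomStar : ∀ i,
      (prodBernoulli w).real {ω : BondConfig (Fin n) | (A.filter fun z => ω ∈ openConn (p i) z).card ≤ j} ≤
          (prodBernoulli w).real {ω : BondConfig (Fin n) | (A.filter fun z => ω ∈ openConn c z).card ≤ j} ∧
        (prodBernoulli w).real {ω : BondConfig (Fin n) | (A.filter fun z => ω ∈ openConn (p' i) z).card ≤ j} ≤
          (prodBernoulli w).real {ω : BondConfig (Fin n) | (A.filter fun z => ω ∈ openConn c z).card ≤ j} := by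
    intro i
    rw [hP i, hP' i]
    exact hdom (cls i)
  have hps : ∀ i k, p i ≠ s k := fun i k h => hsA k (h ▸ hpA i)
  have hp's : ∀ i k, p' i ≠ s k := fun i k h => hsA k (h ▸ hp'A i)
  have hcs : ∀ i, c ≠ s i := fun i h => hsA i (h ▸ hcA)
  rw [← sub_nonneg, setCSdiff_state_expansion w A s p p' c j hs hsA hps hp's hpp' hcs hobs]
  have hre := extreme_regroup (fun i => (w s(s i, p i) : ℝ)) (fun i => (w s(s i, p' i) : ℝ)) (fun i => (w _).2.1)
    (fun i => (w _).2.2) (fun i => (w _).2.1) (fun i => (w _).2.2)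
    (fun t => (prodBernoulli w).real {ω : BondConfig (Fin n) |
        (∀ u ∈ (Finset.univ.filter fun i => (t i).1 = true).image p ∪ (Finset.univ.filter fun i => (t i).2 = true).image p',
          ¬ (openGraph (ω ∩ {e | ∀ v ∈ Finset.univ.image s, v ∉ e})).Reachable c u) ∧
        (A.filter fun z => (openGraph (ω ∩ {e | ∀ v ∈ Finset.univ.image s, v ∉ e})).Reachable c z).card ≤ j} -
      (prodBernoulli w).real {ω : BondConfig (Fin n) |
        (∀ u ∈ (Finset.univ.filter fun i => (t i).1 = true).image p ∪ (Finset.univ.filter fun i => (t i).2 = true).image p',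
          ¬ (openGraph (ω ∩ {e | ∀ v ∈ Finset.univ.image s, v ∉ e})).Reachable c u) ∧
        1 ≤ (A.filter fun z => ∃ u ∈ (Finset.univ.filter fun i => (t i).1 = true).image p ∪
            (Finset.univ.filter fun i => (t i).2 = true).image p',
          (openGraph (ω ∩ {e | ∀ v ∈ Finset.univ.image s, v ∉ e})).Reachable u z).card ∧
        (A.filter fun z => ∃ u ∈ (Finset.univ.filter fun i => (t i).1 = true).image p ∪
            (Finset.univ.filter fun i => (t i).2 = true).image p',
          (openGraph (ω ∩ {e | ∀ v ∈ Finset.univ.image s, v ∉ e})).Reachable u z).card ≤ j})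
  beta_reduce at hre
  rw [hre]
  refine Finset.sum_nonneg fun e _ => mul_nonneg (Finset.prod_nonneg fun i _ =>
    extremeCoeff_nonneg _ _ (w _).2.1 (w _).2.2 (w _).2.1 (w _).2.2 (e i)) ?_
  by_cases he : ∀ i, e i = 0
  · refine comonotoneWord_nonneg_classForest w A s p p' cls P P' hP hP' c j hj hs hsA hPA hP'A hPP' hforest hcA hcP hobs
      (fun I => (hdom I).1) _ ?_
    intro σ
    ext u
    simp only [he, Finset.mem_union, Finset.mem_image, Finset.mem_filter, Finset.mem_univ, true_and]
    constructor
    · rintro (⟨i, hi, rfl⟩ | ⟨i, hi, rfl⟩)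
      · by_cases hiσ : i ∈ σ
        · exact Or.inl ⟨i, hiσ, rfl⟩
        · simp [hiσ] at hi
      · by_cases hiσ : i ∈ σ
        · exact Or.inr ⟨i, hiσ, rfl⟩
        · simp [hiσ] at hi
    · rintro (⟨i, hi, rfl⟩ | ⟨i, hi, rfl⟩)
      · exact Or.inl ⟨i, by simp [hi], rfl⟩
      · exact Or.inr ⟨i, by simp [hi], rfl⟩
  · push Not at he
    obtain ⟨i₀, hi₀⟩ := he
    refine gluedWord_nonneg w A s p p' c j hj hs hsA hpA hp'A hpp' hcA hcp hobs hdomStar e i₀ hi₀ _ ?_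
    intro σ u
    simp only [Finset.mem_union, Finset.mem_image, Finset.mem_filter, Finset.mem_univ, true_and]
    constructor
    · rintro (⟨i, hi, rfl⟩ | ⟨i, hi, rfl⟩)
      · by_cases hiσ : i ∈ σ
        · exact Or.inr (Or.inl ⟨i, hiσ, rfl⟩)
        · simp only [hiσ, if_false, decide_eq_true_eq] at hi
          exact Or.inl (Or.inl ⟨i, hi, rfl⟩)
      · by_cases hiσ : i ∈ σ
        · exact Or.inr (Or.inr ⟨i, hiσ, rfl⟩)
        · simp only [hiσ, if_false, decide_eq_true_eq] at hi
          exact Or.inl (Or.inr ⟨i, hi, rfl⟩)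
    · rintro ((⟨i, hi, rfl⟩ | ⟨i, hi, rfl⟩) | (⟨i, hi, rfl⟩ | ⟨i, hi, rfl⟩))
      · refine Or.inl ⟨i, ?_, rfl⟩
        by_cases hiσ : i ∈ σ
        · simp [hiσ]
        · simp [hiσ, hi]
      · refine Or.inr ⟨i, ?_, rfl⟩
        by_cases hiσ : i ∈ σ
        · simp [hiσ]
        · simp [hiσ, hi]
      · exact Or.inl ⟨i, by simp [hi], rfl⟩
      · exact Or.inr ⟨i, by simp [hi], rfl⟩

end StarSet

end Summit.CriticalPhenomena.PercolationContinuityZ3.Theorems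

end
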